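import Literature.AlgebraicGeometry.ProjectiveSpace.ChaslesTheorem
import Literature.AlgebraicGeometry.ProjectiveSpace.PointsOnHypersurfaceHilbertFunction
import Literature.AlgebraicGeometry.PlaneCurves.ConicThroughFivePoints
import HarnessLib

/-!
# `2d + 2` plane points impose independent conditions on curves of degree `d` unless `d + 2` are
# collinear or all lie on a conic (Eisenbud–Green–Harris 1996, Proposition 1, the case `n = 2d + 2`)

Topic `Literature/AlgebraicGeometry/ProjectiveSpace`, namespace
`Literature.AlgebraicGeometry.ProjectiveSpace`. Lane `lit-hodgefound`, seat `lit-hodgefound-p32`,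
row gen26-#2. Theorems only (no definition, no named fact). Any field `k`.

## The source, as printed

D. Eisenbud, M. Green, J. Harris, *Cayley–Bacharach theorems and conjectures*, Bull. AMS 33 (1996),
§1.1, **Proposition 1** (p. 300). "Let `Ω = {p_1, …, p_n} ⊂ ℙ²` be any collection of `n ≤ 2d + 2`
distinct points. The points of `Ω` fail to impose independent conditions on curves of degree `d` if and
only if either `d + 2` of the points of `Ω` are collinear or `n = 2d + 2` and `Ω` is contained in a
conic." Proof of "only if" (pp. 300–301): "we do induction first on the degree `d` and second on the
number `n` of points. By the induction hypothesis on the number `n` of points we may assume that any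
proper subset of `Ω` does impose independent conditions on curves of degree `d`. Thus the statement that
`Ω` itself fails to impose independent conditions amounts to saying that any plane curve of degree `d`
containing all but one of the points of `Ω` contains `Ω`. … Suppose first that `Ω` contains `d + 1`
points lying on a line `L`. Assume that no further point of `Ω` lies on `L`, and let `Ω'` be the
complementary set of `n − d − 1 ≤ d + 1` points of `Ω`. We claim that `Ω'` must fail to impose
independent conditions on curves of degree `d − 1`; otherwise, we could find a curve `X` of degree
`d − 1` containing all but any one point of `Ω'`, and then the union `L ∪ X` would be a curve of degree
`d` containing all but one point of `Ω`. By induction `Ω'` must consist of exactly `d + 1` points on a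
line `M`. Thus either `L` contains `d + 2` points of `Ω` or `n = 2d + 2` and `Ω` lies on the conic
`L ∪ M`. Next suppose only that some line `L` contains `l ≥ 3` points of `Ω`. By the same argument as in
the last paragraph, the remaining `n − l` points of `Ω` must fail to impose independent conditions on
curves of degree `d − 1` and so must include at least `d + 1` collinear points. … We are now done except
in the case where `Ω` contains no three collinear points. Choose any three points `p_1, p_2, p_3 ∈ Ω`,
and let `Ω'` be the complement of these three. If for any `i` the points of `Ω' ∪ {p_i}` impose
independent conditions on curves of degree `d − 1`, we are done: for then we can find a curve `C` of
degree `d − 1` containing `Ω'` but not `p_i`, and the union of this curve and the line joining `p_j` and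
`p_k` is a curve of degree `d` containing all but exactly one point of `Ω`. Thus we may assume that
`Ω' ∪ {p_i}` fails to impose independent conditions on curves of degree `d − 1`. Since it cannot contain
`d + 1` collinear points, we have by induction `n = 2d + 2`, and for each `i` the set `Ω' ∪ {p_i}` lies
on a conic `C_i`. Note that in case `d = 2` we are done, since six points fail to impose independent
conditions on conics if and only if they lie on a conic. On the other hand, if `d ≥ 3`, then `Ω'`
contains at least five points, no three collinear, and so there can be at most one conic containing
`Ω'`. Thus all the conics `C_i` must be equal to a single conic curve `C`, which then contains all of
`Ω`."

## The proof formalised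

The case `n ≤ 2d + 1` (equivalently ACGH I.A Ex. 19) is the tree's
`IndependentConditionsUnlessCollinear` / `ChaslesTheorem.hilbert_projVanishingIdeal_lt_card_iff_exists_collinear`;
it replaces the printed induction on `n`: every proper subset of a `(2d+2)`-set with no `d + 2`
collinear imposes independent conditions on curves of degree `d`. The printed reduction "any plane
curve of degree `d` containing all but one of the points contains `Ω`" is § 1
(`forall_exists_form_of_exists`: ONE point of `Ω` left out by a curve through the others suffices). The
three printed cases are § 3: a line with `d + 1` of the points (`L ∪ X`, or the conic `L ∪ M`), a line
with `≥ 3` points (`L ∪ X`), no three collinear (`d = 2`: five points lie on a conic; `d ≥ 3`: the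
induction on `d`, the line `p_j p_k`, and "at most one conic through five points with no three
collinear" — the tree's Bix Theorem 5.10, `PlaneCurves.ConicThroughFivePoints`, bridged to this
dictionary in § 2).

## Dictionary

As in `ProjectiveSpace/PointsVanishingIdeal`: points are non-zero, pairwise non-proportional
`P_j : Fin 3 → k`; "collinear" is `∃ u v, ∀ j ∈ s, P_j ∈ span_k {u, v}`; "`Ω` lies on a conic" is: some
non-zero form of degree `2` vanishes at every `P_j`; "imposes independent conditions on curves of degree
`d`" is `H_Z(d) = #Z`, equivalently (`hilbert_projVanishingIdeal_eq_card_iff`) for each point a form of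
degree `d` through the others missing it.

## What is here (all `theorem`s)

* § 1 `forall_exists_form_of_exists` (one omitted point suffices, given that the proper subsets impose
  independent conditions), `exists_form_ne_zero_of_card_lt` (`#T < dim S_d` points lie on a curve of
  degree `d`), `hilbert_projVanishingIdeal_eq_card_iff_of_card_eq_finrank` ("six points fail to impose
  independent conditions on conics if and only if they lie on a conic", for any `#Z = dim S_d`).
* § 2 `mem_span_pair_of_dotProduct_eq_zero`, **`conic_eq_smul_of_collinear_card_le_two`** (at most one
  conic through `≥ 5` points with no three collinear — Bix Thm. 5.10 in this dictionary).
* § 3 **`exists_form_of_card_eq_of_forall_conic`** — the induction on `d`: `2d + 2` distinct points with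
  no `d + 2` collinear and on no conic: for each point a form of degree `d` through the others missing it.
* § 4 **`hilbert_projVanishingIdeal_eq_card_of_forall_conic`** (`H_Z(d) = 2d + 2`),
  **`hilbert_projVanishingIdeal_lt_card_iff_of_card_eq`** (Prop. 1 for `n = 2d + 2`: fail iff `d + 2`
  collinear or on a conic) and **`hilbert_projVanishingIdeal_lt_card_iff_collinear_or_conic`** —
  PROPOSITION 1 AS PRINTED (`n ≤ 2d + 2`).

## References

* [EisenbudGreenHarris1996] D. Eisenbud, M. Green, J. Harris, *Cayley–Bacharach theorems and
  conjectures*, Bull. Amer. Math. Soc. 33 (1996), §1.1, Proposition 1 and its proof (pp. 300–301).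
* [Bix2006] R. Bix, *Conics and Cubics*, 2nd ed., Springer 2006, Theorem 5.10 (the tree's
  `PlaneCurves/ConicThroughFivePoints`, imported).
* [ArbarelloEtAl1985] E. Arbarello, M. Cornalba, P. A. Griffiths, J. Harris, *Geometry of Algebraic
  Curves* I, Ch. I, Appendix A §1, Exercise 19 (p. 56) (the tree's `IndependentConditionsUnlessCollinear`).
-/

noncomputable section

open MvPolynomial Module Matrix
open Literature.RingTheory.MvPolynomial

universe u

namespace Literature.AlgebraicGeometry.ProjectiveSpace

variable {k : Type u} [Field k] {ι : Type*}

/-! ### § 1 One omitted point suffices; `#T < dim S_d` points lie on a curve of degree `d` -/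

/-- **"The statement that `Ω` itself fails to impose independent conditions amounts to saying that any
plane curve of degree `d` containing all but one of the points of `Ω` contains `Ω`"**: if every proper
subset `Ω ∖ {p₀}`-with-one-more-point-omitted is separated by forms of degree `n` (the proper subsets
impose independent conditions) and ONE point `p₀` is missed by a form of degree `n` through the others,
then every point is (subtract a multiple of that form). [cite: EisenbudGreenHarris1996, §1.1, proof of
Prop. 1 (p. 300)] -/
theorem forall_exists_form_of_exists {σ : Type*} (P : ι → σ → k) {n : ℕ} {A : Finset ι} {p₀ : ι}
    (hsub : ∀ p ∈ A, p ≠ p₀ → ∃ G : MvPolynomial σ k, G.IsHomogeneous n ∧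
      (∀ j ∈ A, j ≠ p₀ → j ≠ p → MvPolynomial.eval (P j) G = 0) ∧ MvPolynomial.eval (P p) G ≠ 0)
    (h₀ : ∃ F : MvPolynomial σ k, F.IsHomogeneous n ∧
      (∀ j ∈ A, j ≠ p₀ → MvPolynomial.eval (P j) F = 0) ∧ MvPolynomial.eval (P p₀) F ≠ 0) :
    ∀ p ∈ A, ∃ F : MvPolynomial σ k, F.IsHomogeneous n ∧
      (∀ j ∈ A, j ≠ p → MvPolynomial.eval (P j) F = 0) ∧ MvPolynomial.eval (P p) F ≠ 0 := by
  intro p hp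
  obtain ⟨F₀, hF₀n, hF₀j, hF₀p⟩ := h₀
  by_cases hpp : p = p₀
  · subst hpp
    exact ⟨F₀, hF₀n, hF₀j, hF₀p⟩
  obtain ⟨G, hGn, hGj, hGp⟩ := hsub p hp hpp
  refine ⟨G - (MvPolynomial.eval (P p₀) G / MvPolynomial.eval (P p₀) F₀) • F₀, ?_,
    fun j hj hjp => ?_, ?_⟩
  · rw [← mem_homogeneousSubmodule] at hGn hF₀n ⊢
    exact Submodule.sub_mem _ hGn (Submodule.smul_mem _ _ hF₀n)
  · by_cases hj0 : j = p₀
    · subst hj0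
      rw [map_sub, smul_eval, div_mul_cancel₀ _ hF₀p, sub_self]
    · rw [map_sub, smul_eval, hGj j hj hj0 hjp, hF₀j j hj hj0, mul_zero, sub_zero]
  · rw [map_sub, smul_eval, hF₀j p hp hpp, mul_zero, sub_zero]
    exact hGp

/-- **`#T < dim_k S_d` points lie on a curve of degree `d`**: a non-zero form of degree `d` vanishes at
all of them (they impose at most `#T` conditions). [cite: EisenbudGreenHarris1996, §1.1, proof of
Prop. 1 (p. 301)] -/
theorem exists_form_ne_zero_of_card_lt {σ : Type*} [Fintype σ] (P : ι → σ → k) (T : Finset ι) {d : ℕ}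
    (hT : T.card < finrank k (homogeneousSubmodule σ k d)) :
    ∃ C : MvPolynomial σ k, C.IsHomogeneous d ∧ C ≠ 0 ∧ ∀ j ∈ T, MvPolynomial.eval (P j) C = 0 := by
  classical
  have h := hilbert_projVanishingIdeal_le_card (fun j : T => P j) d
  rw [Fintype.card_coe] at h
  have hpos : 0 < finrank k (idealDegree (projVanishingIdeal (Set.range fun j : T => P j)) d) := by
    omega
  obtain ⟨⟨C, hC⟩, hC0⟩ := Module.finrank_pos_iff_exists_ne_zero.mp hpos
  rw [mem_idealDegree] at hC
  refine ⟨C, hC.2, fun h => hC0 (Subtype.ext h), fun j hj => ?_⟩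
  exact (mem_projVanishingIdeal_iff_of_isHomogeneous hC.2).mp hC.1 _ ⟨⟨j, hj⟩, rfl⟩

/-- **"Six points fail to impose independent conditions on conics if and only if they lie on a conic"**,
in general: `#Z = dim_k S_d` points impose independent conditions on forms of degree `d` iff no non-zero
form of degree `d` vanishes on `Z`. [cite: EisenbudGreenHarris1996, §1.1, proof of Prop. 1 (p. 301)] -/
theorem hilbert_projVanishingIdeal_eq_card_iff_of_card_eq_finrank {σ : Type*} [Fintype σ] [Fintype ι]
    (P : ι → σ → k) {d : ℕ} (hcard : Fintype.card ι = finrank k (homogeneousSubmodule σ k d)) :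
    finrank k (homogeneousSubmodule σ k d) - finrank k (idealDegree (projVanishingIdeal (Set.range P)) d) =
        Fintype.card ι ↔
      ∀ C : MvPolynomial σ k, C.IsHomogeneous d → (∀ i, MvPolynomial.eval (P i) C = 0) → C = 0 := by
  have hle := finrank_idealDegree_le (projVanishingIdeal (Set.range P)) d
  constructor
  · intro h C hC hCZ
    have h0 : finrank k (idealDegree (projVanishingIdeal (Set.range P)) d) = 0 := by omega
    rw [Submodule.finrank_eq_zero] at h0
    have hmem : C ∈ idealDegree (projVanishingIdeal (Set.range P)) d :=
      mem_idealDegree.mpr ⟨mem_projVanishingIdeal_of_isHomogeneous hC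
        (by rintro _ ⟨i, rfl⟩; exact hCZ i), hC⟩
    rw [h0] at hmem
    exact (Submodule.mem_bot k).mp hmem
  · intro h
    have h0 : idealDegree (projVanishingIdeal (Set.range P)) d = ⊥ := by
      rw [eq_bot_iff]
      intro C hC
      rw [mem_idealDegree] at hC
      exact (Submodule.mem_bot k).mpr (h C hC.2 fun i =>
        (mem_projVanishingIdeal_iff_of_isHomogeneous hC.2).mp hC.1 _ ⟨i, rfl⟩)
    rw [h0, finrank_bot, hcard, Nat.sub_zero]

/-! ### § 2 At most one conic through five points with no three collinear (bridge to Bix Thm. 5.10) -/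

/-- Three points on a line `a` (a non-zero covector), two of them distinct: the third is in the span of
the first two (`a` is a multiple of `P₁ × P₂`, and the points of that line are the `αP₁ + βP₂`).
[cite: Bix2006, Thm 2.2] -/
theorem mem_span_pair_of_dotProduct_eq_zero {x y z a : Fin 3 → k} (hxy : LinearIndependent k ![x, y])
    (ha : a ≠ 0) (hx : a ⬝ᵥ x = 0) (hy : a ⬝ᵥ y = 0) (hz : a ⬝ᵥ z = 0) :
    z ∈ Submodule.span k ({x, y} : Set (Fin 3 → k)) := by
  obtain ⟨c, rfl⟩ :=
    Literature.AlgebraicGeometry.PlaneCurves.exists_eq_smul_cross_of_dotProduct_eq_zero hxy hx hy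
  have hc : c ≠ 0 := by
    rintro rfl
    exact ha (zero_smul _ _)
  rw [smul_dotProduct, smul_eq_mul, mul_eq_zero] at hz
  obtain ⟨α, β, h⟩ :=
    Literature.AlgebraicGeometry.PlaneCurves.exists_eq_add_smul_of_cross_dotProduct_eq_zero hxy
      (hz.resolve_left hc)
  exact Submodule.mem_span_pair.mpr ⟨α, β, h.symm⟩

/-- Distinct points of `ℙ²` in this file's sense are linearly independent pairs. [folklore] -/
private theorem linearIndependent_pair_of_notMem {x y : Fin 3 → k} (hy : y ≠ 0)
    (hxy : x ∉ (k ∙ y : Submodule k (Fin 3 → k))) : LinearIndependent k ![x, y] := by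
  rw [linearIndependent_fin2]
  refine ⟨hy, fun a ha => hxy ?_⟩
  exact Submodule.mem_span_singleton.mpr ⟨a, ha⟩

/-- **At most one conic through five points with no three collinear** ("if `d ≥ 3`, then `Ω'` contains
at least five points, no three collinear, and so there can be at most one conic containing `Ω'`"): two
forms of degree `2` vanishing at `≥ 5` distinct points, no three of them collinear, are proportional
(Bix, Theorem 5.10, read in this dictionary). [cite: EisenbudGreenHarris1996, §1.1, proof of Prop. 1
(p. 301)] [cite: Bix2006, Thm 5.10] -/
theorem conic_eq_smul_of_collinear_card_le_two (P : ι → Fin 3 → k) (h0 : ∀ i, P i ≠ 0)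
    (hP : Pairwise fun i j => P i ∉ (k ∙ P j : Submodule k (Fin 3 → k))) (T : Finset ι)
    (hT : 5 ≤ T.card)
    (hcol : ∀ s ⊆ T, (∃ u v : Fin 3 → k, ∀ j ∈ s, P j ∈ Submodule.span k {u, v}) → s.card ≤ 2)
    {C₁ C₂ : MvPolynomial (Fin 3) k} (hC₁ : C₁.IsHomogeneous 2) (hC₂ : C₂.IsHomogeneous 2)
    (hC₁0 : C₁ ≠ 0) (h₁ : ∀ j ∈ T, MvPolynomial.eval (P j) C₁ = 0)
    (h₂ : ∀ j ∈ T, MvPolynomial.eval (P j) C₂ = 0) : ∃ c : k, C₂ = c • C₁ := by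
  classical
  obtain ⟨T', hT'T, hT'card⟩ := Finset.exists_subset_card_eq hT
  let e : Fin 5 ≃ ↥T' :=
    (Fintype.equivFinOfCardEq (by rw [Fintype.card_coe, hT'card]) : ↥T' ≃ Fin 5).symm
  have hne : ∀ m m' : Fin 5, m ≠ m' → ((e m : ι)) ≠ (e m' : ι) := fun m m' hmm' h =>
    hmm' (e.injective (Subtype.ext h))
  refine Literature.AlgebraicGeometry.PlaneCurves.conic_eq_smul_of_five_points_of_no_three_collinear
    (fun m => P (e m)) (fun m m' hmm' => linearIndependent_pair_of_notMem (h0 _) (hP (hne m m' hmm')))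
    ?_ hC₁ hC₂ hC₁0 (fun m => h₁ _ (hT'T (e m).2)) (fun m => h₂ _ (hT'T (e m).2))
  intro a m₁ m₂ m₃ h12 h13 h23 ha1 ha2 ha3
  by_contra ha
  have hmem : P (e m₃) ∈ Submodule.span k ({P (e m₁), P (e m₂)} : Set (Fin 3 → k)) :=
    mem_span_pair_of_dotProduct_eq_zero
      (linearIndependent_pair_of_notMem (h0 _) (hP (hne m₁ m₂ h12))) ha ha1 ha2 ha3
  have hsub : ({(e m₁ : ι), (e m₂ : ι), (e m₃ : ι)} : Finset ι) ⊆ T := by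
    intro j hj
    simp only [Finset.mem_insert, Finset.mem_singleton] at hj
    rcases hj with rfl | rfl | rfl
    · exact hT'T (e m₁).2
    · exact hT'T (e m₂).2
    · exact hT'T (e m₃).2
  have hcard := hcol _ hsub ⟨P (e m₁), P (e m₂), fun j hj => by
    simp only [Finset.mem_insert, Finset.mem_singleton] at hj
    rcases hj with rfl | rfl | rfl
    · exact Submodule.subset_span (Set.mem_insert _ _)
    · exact Submodule.subset_span (Set.mem_insert_of_mem _ (Set.mem_singleton _))
    · exact hmem⟩
  rw [Finset.card_eq_three.mpr ⟨_, _, _, hne m₁ m₂ h12, hne m₁ m₃ h13, hne m₂ m₃ h23, rfl⟩] at hcard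
  omega

/-! ### § 3 Proposition 1, "only if", `n = 2d + 2`: the induction on `d` -/

/-- The span of two vectors is a proper subspace of `k³`. [folklore] -/
private theorem span_pair_ne_top (u v : Fin 3 → k) :
    Submodule.span k ({u, v} : Set (Fin 3 → k)) ≠ ⊤ := by
  classical
  intro h
  have h1 : finrank k (Submodule.span k (({u, v} : Finset (Fin 3 → k)) : Set (Fin 3 → k))) ≤ 2 :=
    (finrank_span_finset_le_card _).trans Finset.card_le_two
  rw [Finset.coe_pair, h, finrank_top, Module.finrank_fintype_fun_eq_card, Fintype.card_fin] at h1
  omega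

/-- A non-zero linear form vanishing on the line spanned by `u, v`. [folklore] -/
private theorem exists_linearForm_of_span_pair (u v : Fin 3 → k) :
    ∃ L : MvPolynomial (Fin 3) k, L.IsHomogeneous 1 ∧ L ≠ 0 ∧
      ∀ w ∈ Submodule.span k ({u, v} : Set (Fin 3 → k)), MvPolynomial.eval w L = 0 := by
  obtain ⟨w, hw⟩ : ∃ w, w ∉ Submodule.span k ({u, v} : Set (Fin 3 → k)) := by
    by_contra h
    push Not at h
    exact span_pair_ne_top u v (eq_top_iff.mpr fun w _ => h w)
  obtain ⟨L, hL1, hLw, hLW⟩ := exists_linearForm_eval_ne_zero _ hw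
  exact ⟨L, hL1, fun h => hLw (by rw [h, map_zero]), hLW⟩

/-- **A pair of lines is a conic**: if `A` splits into two collinear parts then a non-zero form of
degree `2` (the product of the two lines) vanishes on `A` ("`Ω` lies on the conic `L ∪ M`").
[cite: EisenbudGreenHarris1996, §1.1, proof of Prop. 1 (p. 300)] -/
theorem exists_conic_of_collinear_union (P : ι → Fin 3 → k) {A : Finset ι} {u v u' v' : Fin 3 → k}
    (h : ∀ j ∈ A, P j ∈ Submodule.span k ({u, v} : Set (Fin 3 → k)) ∨
      P j ∈ Submodule.span k ({u', v'} : Set (Fin 3 → k))) :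
    ∃ C : MvPolynomial (Fin 3) k, C.IsHomogeneous 2 ∧ C ≠ 0 ∧
      ∀ j ∈ A, MvPolynomial.eval (P j) C = 0 := by
  obtain ⟨L, hL1, hL0, hLW⟩ := exists_linearForm_of_span_pair u v
  obtain ⟨M, hM1, hM0, hMW⟩ := exists_linearForm_of_span_pair u' v'
  refine ⟨L * M, hL1.mul hM1, mul_ne_zero hL0 hM0, fun j hj => ?_⟩
  rw [map_mul]
  rcases h j hj with hj' | hj'
  · rw [hLW _ hj', zero_mul]
  · rw [hMW _ hj', mul_zero]

/-- **"`L ∪ X` is a curve of degree `d` containing all but one point of `Ω`"** (cutting by a line):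
if the points of `A` off the line `Λ = span{u, v}` are `≤ 2d + 1` in number, there is one, and no
`d + 2` of them are collinear, then for some `p ∈ A` off `Λ` a form of degree `d + 1` — the line `Λ`
times a form of degree `d` through the other points off `Λ` (ACGH Ex. A-19) — passes through
`A ∖ {p}` and misses `p`. [cite: EisenbudGreenHarris1996, §1.1, proof of Prop. 1 (pp. 300–301)] -/
private theorem exists_good_point_of_line (P : ι → Fin 3 → k) (h0 : ∀ i, P i ≠ 0)
    (hP : Pairwise fun i j => P i ∉ (k ∙ P j : Submodule k (Fin 3 → k))) {d : ℕ} {A A'' : Finset ι}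
    {u v : Fin 3 → k}
    (hA'' : ∀ j, j ∈ A'' ↔ j ∈ A ∧ P j ∉ Submodule.span k ({u, v} : Set (Fin 3 → k)))
    (hoff : A''.card ≤ 2 * d + 1) (hne : A''.Nonempty)
    (hcol : ∀ s ⊆ A'', (∃ u' v' : Fin 3 → k, ∀ j ∈ s, P j ∈ Submodule.span k {u', v'}) →
      s.card ≤ d + 1) :
    ∃ p ∈ A, ∃ F : MvPolynomial (Fin 3) k, F.IsHomogeneous (d + 1) ∧
      (∀ j ∈ A, j ≠ p → MvPolynomial.eval (P j) F = 0) ∧ MvPolynomial.eval (P p) F ≠ 0 := by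
  classical
  obtain ⟨p, hp⟩ := hne
  obtain ⟨hpA, hpuv⟩ := (hA'' p).mp hp
  obtain ⟨L, hL1, hLp, hLW⟩ :=
    exists_linearForm_eval_ne_zero (Submodule.span k ({u, v} : Set (Fin 3 → k))) hpuv
  obtain ⟨G, hGdeg, hGj, hGp⟩ := exists_form_of_collinear_card_le P h0 hP d _ hoff hcol p hp
  refine ⟨p, hpA, L * G, ?_, fun j hj hjp => ?_, ?_⟩
  · have h := hL1.mul hGdeg
    rwa [add_comm] at h
  · rw [map_mul]
    by_cases hjW : P j ∈ Submodule.span k ({u, v} : Set (Fin 3 → k))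
    · rw [hLW _ hjW, zero_mul]
    · rw [hGj j ((hA'' j).mpr ⟨hj, hjW⟩) hjp, mul_zero]
  · rw [map_mul]
    exact mul_ne_zero hLp hGp

/-- **"The union of this curve and the line joining `p_j` and `p_k`"**: from a form `G` of degree `d`
through `Ω` missing `a`, where `A ∖ Ω ⊆ {a, b, c}` and `P_a` is off the line `P_b P_c`, the form
`L_{bc} · G` of degree `d + 1` passes through `A ∖ {a}` and misses `a`.
[cite: EisenbudGreenHarris1996, §1.1, proof of Prop. 1 (p. 301)] -/
private theorem exists_form_mul_line (P : ι → Fin 3 → k) {d : ℕ} {A Ω : Finset ι} {a b c : ι}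
    (hcover : ∀ j ∈ A, j ∉ Ω → j = a ∨ j = b ∨ j = c)
    (hnot : P a ∉ Submodule.span k ({P b, P c} : Set (Fin 3 → k)))
    {G : MvPolynomial (Fin 3) k} (hG : G.IsHomogeneous d)
    (hGj : ∀ j ∈ Ω, MvPolynomial.eval (P j) G = 0) (hGa : MvPolynomial.eval (P a) G ≠ 0) :
    ∃ F : MvPolynomial (Fin 3) k, F.IsHomogeneous (d + 1) ∧
      (∀ j ∈ A, j ≠ a → MvPolynomial.eval (P j) F = 0) ∧ MvPolynomial.eval (P a) F ≠ 0 := by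
  obtain ⟨L, hL1, hLa, hLW⟩ :=
    exists_linearForm_eval_ne_zero (Submodule.span k ({P b, P c} : Set (Fin 3 → k))) hnot
  refine ⟨L * G, ?_, fun j hj hja => ?_, ?_⟩
  · have h := hL1.mul hG
    rwa [add_comm] at h
  · rw [map_mul]
    by_cases hjΩ : j ∈ Ω
    · rw [hGj j hjΩ, mul_zero]
    · rcases hcover j hj hjΩ with rfl | rfl | rfl
      · exact absurd rfl hja
      · rw [hLW _ (Submodule.subset_span (Set.mem_insert _ _)), zero_mul]
      · rw [hLW _ (Submodule.subset_span (Set.mem_insert_of_mem _ (Set.mem_singleton _))), zero_mul]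
  · rw [map_mul]
    exact mul_ne_zero hLa hGa

/-- With no three of the points collinear, a point is off the line through two others. [folklore] -/
private theorem notMem_span_pair_of_collinear_card_le_two (P : ι → Fin 3 → k) {A : Finset ι}
    (hcol2 : ∀ s ⊆ A, (∃ u v : Fin 3 → k, ∀ j ∈ s, P j ∈ Submodule.span k {u, v}) → s.card ≤ 2)
    {a b c : ι} (ha : a ∈ A) (hb : b ∈ A) (hc : c ∈ A) (hab : a ≠ b) (hac : a ≠ c) (hbc : b ≠ c) :
    P a ∉ Submodule.span k ({P b, P c} : Set (Fin 3 → k)) := by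
  classical
  intro h
  have hsub : ({a, b, c} : Finset ι) ⊆ A := by
    intro j hj
    simp only [Finset.mem_insert, Finset.mem_singleton] at hj
    rcases hj with rfl | rfl | rfl
    · exact ha
    · exact hb
    · exact hc
  have hcard := hcol2 {a, b, c} hsub ⟨P b, P c, fun j hj => by
    simp only [Finset.mem_insert, Finset.mem_singleton] at hj
    rcases hj with rfl | rfl | rfl
    · exact h
    · exact Submodule.subset_span (Set.mem_insert _ _)
    · exact Submodule.subset_span (Set.mem_insert_of_mem _ (Set.mem_singleton _))⟩
  rw [Finset.card_eq_three.mpr ⟨a, b, c, hab, hac, hbc, rfl⟩] at hcard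
  omega

/-- **EGH Proposition 1, "only if", the case `n = 2d + 2` (the induction on `d`).** Let the `P_i` be
non-zero and pairwise non-proportional, `A` a set of `2d + 2` indices such that every collinear subset
of `A` has at most `d + 1` points and no non-zero form of degree `2` vanishes at all the `P_j`, `j ∈ A`.
Then for every `p ∈ A` there is a form of degree `d` vanishing at the `P_j`, `j ∈ A ∖ {p}`, and not at
`P_p` — `A` imposes independent conditions on curves of degree `d`. (Cases, after the reduction to one
omitted point: a line with `d + 1` of the points — cut by it, the rest being `d + 1` non-collinear
points, or else `A` lies on a pair of lines; a line with `≥ 3` points — cut by it; no three collinear —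
for `d = 2` the other five points lie on a conic missing the sixth, for `d ≥ 3` induction on
`Ω' ∪ {p_i}` and the uniqueness of the conic through `Ω'`.)
[cite: EisenbudGreenHarris1996, §1.1, Prop. 1 and its proof (pp. 300–301)] -/
theorem exists_form_of_card_eq_of_forall_conic (P : ι → Fin 3 → k) (h0 : ∀ i, P i ≠ 0)
    (hP : Pairwise fun i j => P i ∉ (k ∙ P j : Submodule k (Fin 3 → k))) :
    ∀ (d : ℕ) (A : Finset ι), A.card = 2 * d + 2 →
      (∀ s ⊆ A, (∃ u v : Fin 3 → k, ∀ j ∈ s, P j ∈ Submodule.span k {u, v}) → s.card ≤ d + 1) →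
      (∀ C : MvPolynomial (Fin 3) k, C.IsHomogeneous 2 →
        (∀ j ∈ A, MvPolynomial.eval (P j) C = 0) → C = 0) →
      ∀ p ∈ A, ∃ F : MvPolynomial (Fin 3) k, F.IsHomogeneous d ∧
        (∀ j ∈ A, j ≠ p → MvPolynomial.eval (P j) F = 0) ∧ MvPolynomial.eval (P p) F ≠ 0 := by
  classical
  intro d
  induction d with
  | zero =>
    -- two points are collinear: the hypotheses are contradictory
    intro A hA hcol _ p _
    exfalso
    obtain ⟨a, b, hab, rfl⟩ := Finset.card_eq_two.mp (by omega : A.card = 2)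
    have h := hcol {a, b} (Finset.Subset.refl _) ⟨P a, P b, fun j hj => by
      simp only [Finset.mem_insert, Finset.mem_singleton] at hj
      rcases hj with rfl | rfl
      · exact Submodule.subset_span (Set.mem_insert _ _)
      · exact Submodule.subset_span (Set.mem_insert_of_mem _ (Set.mem_singleton _))⟩
    rw [Finset.card_pair hab] at h
    omega
  | succ d ih =>
    intro A hA hcol hconic
    -- it suffices to find ONE point missed by a curve of degree `d + 1` through the others: the proper
    -- subsets (`2d + 3 = 2(d+1) + 1` points, no `d + 3` collinear) impose independent conditions
    suffices hone : ∃ p₀ ∈ A, ∃ F : MvPolynomial (Fin 3) k, F.IsHomogeneous (d + 1) ∧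
        (∀ j ∈ A, j ≠ p₀ → MvPolynomial.eval (P j) F = 0) ∧ MvPolynomial.eval (P p₀) F ≠ 0 by
      obtain ⟨p₀, hp₀, hF₀⟩ := hone
      refine forall_exists_form_of_exists P (fun p hp hpp₀ => ?_) hF₀
      obtain ⟨G, hGn, hGj, hGp⟩ := exists_form_of_collinear_card_le P h0 hP (d + 1) (A.erase p₀)
        (by rw [Finset.card_erase_of_mem hp₀, hA]; omega)
        (fun s hs hcs => hcol s (hs.trans (Finset.erase_subset _ _)) hcs) p
        (Finset.mem_erase.mpr ⟨hpp₀, hp⟩)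
      exact ⟨G, hGn, fun j hj hj0 hjp => hGj j (Finset.mem_erase.mpr ⟨hj0, hj⟩) hjp, hGp⟩
    -- `d + 1 = 1` (lines, four points): four points lie on a pair of lines — contradiction
    rcases Nat.eq_zero_or_pos d with rfl | hdpos
    · exfalso
      obtain ⟨a, ha⟩ : A.Nonempty := Finset.card_pos.mp (by omega)
      have h3 : (A.erase a).card = 3 := by rw [Finset.card_erase_of_mem ha, hA]
      obtain ⟨b, c, e, -, -, -, hbce⟩ := Finset.card_eq_three.mp h3
      have hmem : ∀ j ∈ A, j = a ∨ j = b ∨ j = c ∨ j = e := by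
        intro j hj
        by_cases hja : j = a
        · exact Or.inl hja
        · have h : j ∈ A.erase a := Finset.mem_erase.mpr ⟨hja, hj⟩
          rw [hbce] at h
          simp only [Finset.mem_insert, Finset.mem_singleton] at h
          exact Or.inr h
      obtain ⟨C, hC, hC0, hCZ⟩ := exists_conic_of_collinear_union P (A := A) (u := P a) (v := P b)
        (u' := P c) (v' := P e) (fun j hj => by
          rcases hmem j hj with rfl | rfl | rfl | rfl
          · exact Or.inl (Submodule.subset_span (Set.mem_insert _ _))
          · exact Or.inl (Submodule.subset_span (Set.mem_insert_of_mem _ (Set.mem_singleton _)))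
          · exact Or.inr (Submodule.subset_span (Set.mem_insert _ _))
          · exact Or.inr (Submodule.subset_span (Set.mem_insert_of_mem _ (Set.mem_singleton _))))
      exact hC0 (hconic C hC hCZ)
    -- Case I: a line `Λ` with `d + 2` of the points; then exactly `d + 2`, and `d + 2` points off it
    by_cases hI : ∃ s ⊆ A, s.card = d + 2 ∧
        ∃ u v : Fin 3 → k, ∀ j ∈ s, P j ∈ Submodule.span k ({u, v} : Set (Fin 3 → k))
    · obtain ⟨s, hsA, hscard, u, v, huv⟩ := hI
      set s₁ := A.filter (fun j => P j ∈ Submodule.span k ({u, v} : Set (Fin 3 → k))) with hs₁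
      set A'' := A \ s₁ with hA''
      have hmemA'' : ∀ j, j ∈ A'' ↔ j ∈ A ∧ P j ∉ Submodule.span k ({u, v} : Set (Fin 3 → k)) := by
        intro j
        rw [hA'', Finset.mem_sdiff, hs₁, Finset.mem_filter]
        tauto
      have hs₁card : s₁.card = d + 2 := by
        refine le_antisymm (hcol s₁ (Finset.filter_subset _ _)
          ⟨u, v, fun j hj => (Finset.mem_filter.mp hj).2⟩) ?_
        rw [← hscard]
        exact Finset.card_le_card fun j hj => Finset.mem_filter.mpr ⟨hsA hj, huv j hj⟩
      have hA''card : A''.card = d + 2 := by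
        rw [hA'', Finset.card_sdiff_of_subset (Finset.filter_subset _ _), hs₁card, hA]
        omega
      by_cases hcolA'' : ∀ s' ⊆ A'', (∃ u' v' : Fin 3 → k, ∀ j ∈ s', P j ∈ Submodule.span k {u', v'}) →
          s'.card ≤ d + 1
      · -- the `d + 2` points off `Λ` are not collinear: cut by `Λ`
        exact exists_good_point_of_line P h0 hP hmemA'' (by omega) (Finset.card_pos.mp (by omega))
          hcolA''
      · -- the points off `Λ` are collinear: `A` lies on a pair of lines
        exfalso
        push Not at hcolA''
        obtain ⟨s', hs'A'', ⟨u', v', huv'⟩, hs'card⟩ := hcolA''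
        have hs'eq : s' = A'' := Finset.eq_of_subset_of_card_le hs'A'' (by omega)
        obtain ⟨C, hC, hC0, hCZ⟩ := exists_conic_of_collinear_union P (A := A) (u := u) (v := v)
          (u' := u') (v' := v') (fun j hj => by
            by_cases hjW : P j ∈ Submodule.span k ({u, v} : Set (Fin 3 → k))
            · exact Or.inl hjW
            · exact Or.inr (huv' j (by rw [hs'eq]; exact (hmemA'' j).mpr ⟨hj, hjW⟩)))
        exact hC0 (hconic C hC hCZ)
    -- so every collinear subset of `A` has at most `d + 1` points
    have hcol' : ∀ s ⊆ A, (∃ u v : Fin 3 → k, ∀ j ∈ s, P j ∈ Submodule.span k {u, v}) →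
        s.card ≤ d + 1 := by
      intro s hsA hs
      by_contra hlt
      obtain ⟨s', hs's, hs'card⟩ := Finset.exists_subset_card_eq (s := s) (n := d + 2) (by omega)
      obtain ⟨u, v, huv⟩ := hs
      exact hI ⟨s', hs's.trans hsA, hs'card, u, v, fun j hj => huv j (hs's hj)⟩
    -- Case II: a line `Λ` with at least three of the points: cut by `Λ`
    by_cases hII : ∃ u v : Fin 3 → k,
        3 ≤ (A.filter fun j => P j ∈ Submodule.span k ({u, v} : Set (Fin 3 → k))).card
    · obtain ⟨u, v, h3⟩ := hII
      set s₁ := A.filter (fun j => P j ∈ Submodule.span k ({u, v} : Set (Fin 3 → k))) with hs₁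
      set A'' := A \ s₁ with hA''
      have hmemA'' : ∀ j, j ∈ A'' ↔ j ∈ A ∧ P j ∉ Submodule.span k ({u, v} : Set (Fin 3 → k)) := by
        intro j
        rw [hA'', Finset.mem_sdiff, hs₁, Finset.mem_filter]
        tauto
      have hs₁le : s₁.card ≤ d + 1 :=
        hcol' _ (Finset.filter_subset _ _) ⟨u, v, fun j hj => (Finset.mem_filter.mp hj).2⟩
      have hA''card : A''.card = A.card - s₁.card := by
        rw [hA'', Finset.card_sdiff_of_subset (Finset.filter_subset _ _)]
      exact exists_good_point_of_line P h0 hP hmemA'' (by omega) (Finset.card_pos.mp (by omega))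
        (fun s' hs' hcs' => hcol' s' (hs'.trans Finset.sdiff_subset) hcs')
    -- Case III: no three of the points are collinear
    have hcol2 : ∀ s ⊆ A, (∃ u v : Fin 3 → k, ∀ j ∈ s, P j ∈ Submodule.span k {u, v}) →
        s.card ≤ 2 := by
      rintro s hsA ⟨u, v, huv⟩
      by_contra hlt
      refine hII ⟨u, v, ?_⟩
      calc 3 ≤ s.card := by omega
        _ ≤ _ := Finset.card_le_card fun j hj => Finset.mem_filter.mpr ⟨hsA hj, huv j hj⟩
    obtain ⟨p₁, hp₁⟩ : A.Nonempty := Finset.card_pos.mp (by omega)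
    -- `d + 1 = 2` (conics, six points): the five other points lie on a conic, which misses the sixth
    by_cases hd1 : d = 1
    · subst hd1
      obtain ⟨C, hC, hC0, hCZ⟩ := exists_form_ne_zero_of_card_lt P (A.erase p₁) (d := 2)
        (by rw [Finset.card_erase_of_mem hp₁, hA, finrank_homogeneousSubmodule_fin_three]; decide)
      refine ⟨p₁, hp₁, C, hC, fun j hj hjp => hCZ j (Finset.mem_erase.mpr ⟨hjp, hj⟩), fun hCp =>
        hC0 (hconic C hC fun j hj => ?_)⟩
      by_cases hjp : j = p₁
      · rw [hjp]
        exact hCp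
      · exact hCZ j (Finset.mem_erase.mpr ⟨hjp, hj⟩)
    -- `d + 1 ≥ 3`: three points `p₁, p₂, p₃` and `Ω = A ∖ {p₁, p₂, p₃}` (`2d + 1 ≥ 5` points)
    have hd2 : 2 ≤ d := by omega
    obtain ⟨p₂, hp₂, hp₂₁⟩ : ∃ p₂ ∈ A, p₂ ≠ p₁ := by
      obtain ⟨p₂, hp₂⟩ : (A.erase p₁).Nonempty :=
        Finset.card_pos.mp (by rw [Finset.card_erase_of_mem hp₁]; omega)
      exact ⟨p₂, Finset.mem_of_mem_erase hp₂, Finset.ne_of_mem_erase hp₂⟩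
    obtain ⟨p₃, hp₃, hp₃₁, hp₃₂⟩ : ∃ p₃ ∈ A, p₃ ≠ p₁ ∧ p₃ ≠ p₂ := by
      obtain ⟨p₃, hp₃⟩ : ((A.erase p₁).erase p₂).Nonempty :=
        Finset.card_pos.mp (by
          rw [Finset.card_erase_of_mem (Finset.mem_erase.mpr ⟨hp₂₁, hp₂⟩),
            Finset.card_erase_of_mem hp₁]
          omega)
      exact ⟨p₃, Finset.mem_of_mem_erase (Finset.mem_of_mem_erase hp₃),
        Finset.ne_of_mem_erase (Finset.mem_of_mem_erase hp₃), Finset.ne_of_mem_erase hp₃⟩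
    set T : Finset ι := {p₁, p₂, p₃} with hT
    have hTA : T ⊆ A := by
      intro j hj
      simp only [hT, Finset.mem_insert, Finset.mem_singleton] at hj
      rcases hj with rfl | rfl | rfl
      · exact hp₁
      · exact hp₂
      · exact hp₃
    have hTcard : T.card = 3 :=
      Finset.card_eq_three.mpr ⟨p₁, p₂, p₃, hp₂₁.symm, hp₃₁.symm, hp₃₂.symm, rfl⟩
    set Ω : Finset ι := A \ T with hΩ
    have hΩA : Ω ⊆ A := Finset.sdiff_subset
    have hΩcard : Ω.card = 2 * d + 1 := by
      rw [hΩ, Finset.card_sdiff_of_subset hTA, hA, hTcard]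
      omega
    have hmemΩ : ∀ j, j ∈ Ω ↔ j ∈ A ∧ ¬(j = p₁ ∨ j = p₂ ∨ j = p₃) := by
      intro j
      rw [hΩ, Finset.mem_sdiff, hT]
      simp only [Finset.mem_insert, Finset.mem_singleton]
    have hcover : ∀ j ∈ A, j ∉ Ω → j = p₁ ∨ j = p₂ ∨ j = p₃ := by
      intro j hj hjΩ
      by_contra h
      exact hjΩ ((hmemΩ j).mpr ⟨hj, h⟩)
    have hp₁Ω : p₁ ∉ Ω := fun h => ((hmemΩ p₁).mp h).2 (Or.inl rfl)
    have hp₂Ω : p₂ ∉ Ω := fun h => ((hmemΩ p₂).mp h).2 (Or.inr (Or.inl rfl))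
    have hp₃Ω : p₃ ∉ Ω := fun h => ((hmemΩ p₃).mp h).2 (Or.inr (Or.inr rfl))
    -- if `Ω ∪ {a}` lies on no conic, induction gives a curve of degree `d` through `Ω` missing `a`,
    -- and with the line through the other two points we are done
    have key : ∀ a b c : ι, a ∈ A → b ∈ A → c ∈ A → a ∉ Ω → a ≠ b → a ≠ c → b ≠ c →
        (∀ j ∈ A, j ∉ Ω → j = a ∨ j = b ∨ j = c) →
        (∀ C : MvPolynomial (Fin 3) k, C.IsHomogeneous 2 →
          (∀ j ∈ insert a Ω, MvPolynomial.eval (P j) C = 0) → C = 0) →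
        ∃ p₀ ∈ A, ∃ F : MvPolynomial (Fin 3) k, F.IsHomogeneous (d + 1) ∧
          (∀ j ∈ A, j ≠ p₀ → MvPolynomial.eval (P j) F = 0) ∧ MvPolynomial.eval (P p₀) F ≠ 0 := by
      intro a b c ha hb hc haΩ hab hac hbc hcov hfree
      have hBcard : (insert a Ω).card = 2 * d + 2 := by
        rw [Finset.card_insert_of_notMem haΩ, hΩcard]
      have hBcol : ∀ s ⊆ insert a Ω, (∃ u v : Fin 3 → k, ∀ j ∈ s, P j ∈ Submodule.span k {u, v}) →
          s.card ≤ d + 1 := by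
        intro s hs hcs
        have h := hcol2 s (hs.trans (Finset.insert_subset ha hΩA)) hcs
        omega
      obtain ⟨G, hGn, hGj, hGa⟩ := ih (insert a Ω) hBcard hBcol hfree a (Finset.mem_insert_self _ _)
      exact ⟨a, ha, exists_form_mul_line P hcov
        (notMem_span_pair_of_collinear_card_le_two P hcol2 ha hb hc hab hac hbc) hGn
        (fun j hj => hGj j (Finset.mem_insert_of_mem hj) (fun h => haΩ (h ▸ hj))) hGa⟩
    by_cases hf₁ : ∀ C : MvPolynomial (Fin 3) k, C.IsHomogeneous 2 →
        (∀ j ∈ insert p₁ Ω, MvPolynomial.eval (P j) C = 0) → C = 0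
    · exact key p₁ p₂ p₃ hp₁ hp₂ hp₃ hp₁Ω hp₂₁.symm hp₃₁.symm hp₃₂.symm hcover hf₁
    by_cases hf₂ : ∀ C : MvPolynomial (Fin 3) k, C.IsHomogeneous 2 →
        (∀ j ∈ insert p₂ Ω, MvPolynomial.eval (P j) C = 0) → C = 0
    · exact key p₂ p₁ p₃ hp₂ hp₁ hp₃ hp₂Ω hp₂₁ hp₃₂.symm hp₃₁.symm
        (fun j hj hjΩ => (hcover j hj hjΩ).elim (fun h => Or.inr (Or.inl h))
          fun h => h.elim (fun h => Or.inl h) fun h => Or.inr (Or.inr h)) hf₂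
    by_cases hf₃ : ∀ C : MvPolynomial (Fin 3) k, C.IsHomogeneous 2 →
        (∀ j ∈ insert p₃ Ω, MvPolynomial.eval (P j) C = 0) → C = 0
    · exact key p₃ p₁ p₂ hp₃ hp₁ hp₂ hp₃Ω hp₃₁ hp₃₂ hp₂₁.symm
        (fun j hj hjΩ => (hcover j hj hjΩ).elim (fun h => Or.inr (Or.inl h))
          fun h => h.elim (fun h => Or.inr (Or.inr h)) fun h => Or.inl h) hf₃
    -- all three `Ω ∪ {p_i}` lie on conics `C_i`: these pass through the `≥ 5` points of `Ω`, no three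
    -- collinear, so they are proportional, and `C₁` passes through all of `A`
    exfalso
    push Not at hf₁ hf₂ hf₃
    obtain ⟨C₁, hC₁, hC₁Z, hC₁0⟩ := hf₁
    obtain ⟨C₂, hC₂, hC₂Z, hC₂0⟩ := hf₂
    obtain ⟨C₃, hC₃, hC₃Z, hC₃0⟩ := hf₃
    have hcolΩ : ∀ s ⊆ Ω, (∃ u v : Fin 3 → k, ∀ j ∈ s, P j ∈ Submodule.span k {u, v}) →
        s.card ≤ 2 := fun s hs hcs => hcol2 s (hs.trans hΩA) hcs
    obtain ⟨c₂, hc₂⟩ := conic_eq_smul_of_collinear_card_le_two P h0 hP Ω (by omega) hcolΩ hC₁ hC₂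
      hC₁0 (fun j hj => hC₁Z j (Finset.mem_insert_of_mem hj))
      (fun j hj => hC₂Z j (Finset.mem_insert_of_mem hj))
    obtain ⟨c₃, hc₃⟩ := conic_eq_smul_of_collinear_card_le_two P h0 hP Ω (by omega) hcolΩ hC₁ hC₃
      hC₁0 (fun j hj => hC₁Z j (Finset.mem_insert_of_mem hj))
      (fun j hj => hC₃Z j (Finset.mem_insert_of_mem hj))
    have hc₂0 : c₂ ≠ 0 := by
      rintro rfl
      exact hC₂0 (by rw [hc₂, zero_smul])
    have hc₃0 : c₃ ≠ 0 := by
      rintro rfl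
      exact hC₃0 (by rw [hc₃, zero_smul])
    refine hC₁0 (hconic C₁ hC₁ fun j hj => ?_)
    by_cases hjΩ : j ∈ Ω
    · exact hC₁Z j (Finset.mem_insert_of_mem hjΩ)
    rcases hcover j hj hjΩ with rfl | rfl | rfl
    · exact hC₁Z _ (Finset.mem_insert_self _ _)
    · have h := hC₂Z _ (Finset.mem_insert_self _ _)
      rw [hc₂, smul_eval, mul_eq_zero] at h
      exact h.resolve_left hc₂0
    · have h := hC₃Z _ (Finset.mem_insert_self _ _)
      rw [hc₃, smul_eval, mul_eq_zero] at h
      exact h.resolve_left hc₃0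

/-! ### § 4 Proposition 1 -/

/-- **`2d + 2` distinct plane points with no `d + 2` collinear and on no conic impose independent
conditions on curves of degree `d`**: `H_Z(d) = #Z = 2d + 2`.
[cite: EisenbudGreenHarris1996, §1.1, Prop. 1 (p. 300)] -/
theorem hilbert_projVanishingIdeal_eq_card_of_forall_conic [Fintype ι] (P : ι → Fin 3 → k)
    (h0 : ∀ i, P i ≠ 0) (hP : Pairwise fun i j => P i ∉ (k ∙ P j : Submodule k (Fin 3 → k))) {d : ℕ}
    (hcard : Fintype.card ι = 2 * d + 2)
    (hcol : ∀ s : Finset ι, (∃ u v : Fin 3 → k, ∀ j ∈ s, P j ∈ Submodule.span k {u, v}) →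
      s.card ≤ d + 1)
    (hconic : ∀ C : MvPolynomial (Fin 3) k, C.IsHomogeneous 2 →
      (∀ i, MvPolynomial.eval (P i) C = 0) → C = 0) :
    finrank k (homogeneousSubmodule (Fin 3) k d) -
      finrank k (idealDegree (projVanishingIdeal (Set.range P)) d) = Fintype.card ι := by
  classical
  refine (hilbert_projVanishingIdeal_eq_card_iff P d).mpr fun i => ?_
  obtain ⟨F, hF, hFj, hFi⟩ := exists_form_of_card_eq_of_forall_conic P h0 hP d Finset.univ
    (by rw [Finset.card_univ, hcard]) (fun s _ hs => hcol s hs)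
    (fun C hC hCZ => hconic C hC fun i => hCZ i (Finset.mem_univ _)) i (Finset.mem_univ i)
  exact ⟨F, hF, fun j hj => hFj j (Finset.mem_univ j) hj, hFi⟩

/-- **EGH Proposition 1 for `n = 2d + 2` distinct plane points: they fail to impose independent
conditions on curves of degree `d` if and only if `d + 2` of them are collinear or they all lie on a
conic.** [cite: EisenbudGreenHarris1996, §1.1, Prop. 1 (p. 300)] -/
theorem hilbert_projVanishingIdeal_lt_card_iff_of_card_eq [Fintype ι] (P : ι → Fin 3 → k)
    (h0 : ∀ i, P i ≠ 0) (hP : Pairwise fun i j => P i ∉ (k ∙ P j : Submodule k (Fin 3 → k))) {d : ℕ}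
    (hcard : Fintype.card ι = 2 * d + 2) :
    finrank k (homogeneousSubmodule (Fin 3) k d) -
        finrank k (idealDegree (projVanishingIdeal (Set.range P)) d) < Fintype.card ι ↔
      (∃ s : Finset ι, s.card = d + 2 ∧ ∃ u v : Fin 3 → k, ∀ j ∈ s, P j ∈ Submodule.span k {u, v}) ∨
        ∃ C : MvPolynomial (Fin 3) k, C.IsHomogeneous 2 ∧ C ≠ 0 ∧
          ∀ i, MvPolynomial.eval (P i) C = 0 := by
  classical
  constructor
  · intro hlt
    by_contra hnot
    rw [not_or] at hnot
    obtain ⟨hnc, hnq⟩ := hnot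
    have hcol : ∀ s : Finset ι, (∃ u v : Fin 3 → k, ∀ j ∈ s, P j ∈ Submodule.span k {u, v}) →
        s.card ≤ d + 1 := by
      rintro s ⟨u, v, huv⟩
      by_contra hgt
      obtain ⟨s', hs', hs'card⟩ := Finset.exists_subset_card_eq (s := s) (n := d + 2) (by omega)
      exact hnc ⟨s', hs'card, u, v, fun j hj => huv j (hs' hj)⟩
    have hconic : ∀ C : MvPolynomial (Fin 3) k, C.IsHomogeneous 2 →
        (∀ i, MvPolynomial.eval (P i) C = 0) → C = 0 := by
      intro C hC hCZ
      by_contra hC0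
      exact hnq ⟨C, hC, hC0, hCZ⟩
    have h := hilbert_projVanishingIdeal_eq_card_of_forall_conic P h0 hP hcard hcol hconic
    omega
  · rintro (⟨s, hs, hcol⟩ | ⟨C, hC, hC0, hCZ⟩)
    · exact hilbert_projVanishingIdeal_lt_card_of_collinear P s hs hcol
    · exact hilbert_projVanishingIdeal_lt_card_of_conic P hC hC0 hCZ (by omega)

/-- **EGH Proposition 1, as printed.** "Let `Ω = {p_1, …, p_n} ⊂ ℙ²` be any collection of `n ≤ 2d + 2`
distinct points. The points of `Ω` fail to impose independent conditions on curves of degree `d` if and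
only if either `d + 2` of the points of `Ω` are collinear or `n = 2d + 2` and `Ω` is contained in a
conic." (Any field; the points as non-zero pairwise non-proportional vectors.)
[cite: EisenbudGreenHarris1996, §1.1, Prop. 1 (p. 300)] -/
theorem hilbert_projVanishingIdeal_lt_card_iff_collinear_or_conic [Fintype ι] (P : ι → Fin 3 → k)
    (h0 : ∀ i, P i ≠ 0) (hP : Pairwise fun i j => P i ∉ (k ∙ P j : Submodule k (Fin 3 → k))) {d : ℕ}
    (hcard : Fintype.card ι ≤ 2 * d + 2) :
    finrank k (homogeneousSubmodule (Fin 3) k d) -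
        finrank k (idealDegree (projVanishingIdeal (Set.range P)) d) < Fintype.card ι ↔
      (∃ s : Finset ι, s.card = d + 2 ∧ ∃ u v : Fin 3 → k, ∀ j ∈ s, P j ∈ Submodule.span k {u, v}) ∨
        (Fintype.card ι = 2 * d + 2 ∧ ∃ C : MvPolynomial (Fin 3) k, C.IsHomogeneous 2 ∧ C ≠ 0 ∧
          ∀ i, MvPolynomial.eval (P i) C = 0) := by
  rcases Nat.lt_or_ge (Fintype.card ι) (2 * d + 2) with hlt | hge
  · rw [hilbert_projVanishingIdeal_lt_card_iff_exists_collinear P h0 hP (by omega)]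
    constructor
    · exact Or.inl
    · rintro (h | ⟨h, -⟩)
      · exact h
      · omega
  · have heq : Fintype.card ι = 2 * d + 2 := le_antisymm hcard hge
    rw [hilbert_projVanishingIdeal_lt_card_iff_of_card_eq P h0 hP heq]
    simp only [heq, true_and]

end Literature.AlgebraicGeometry.ProjectiveSpace

end
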